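import Literature.Analysis.FluidPDE.EyinkBalanceOfMatrix
import Literature.Analysis.FluidPDE.NovackMatrixKernelCubicIdentity
import Literature.Analysis.FluidPDE.NovackMatrixKernelTestFieldProofs
import Literature.Analysis.FluidPDE.EyinkUniformDefectTransverse
import Literature.Analysis.FluidPDE.EyinkUniformDefectOfEuler
import HarnessLib

/-!
# The uniform transverse Eyink defect of weak Euler solutions; the local 4/5 law from the pressure fact

Topic: Analysis/FluidPDE, proofs. Third file (after `EyinkMatrixKernels`, `EyinkBalanceOfMatrix`) of
the reduction of the accepted named fact `Torus.HasDuchonRobertDefect.hasFourFifthsLaw`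
(`DissipationAnomaly`; Eyink 2003, Thm. 1 / Cor. 1, made unconditional) to the printed steps of
Eyink's proof. Everything here is proved; the auxiliary definitions are the radial cut-offs
`Torus.unitCutoff`, `Torus.cutoff κ`, the excised and remainder profiles `Torus.excise φ κ = φ(1 − χ_κ)`,
`Torus.remainder φ κ = φχ_κ`, and the radial weight `Torus.transverseWeight d φ ε` of Eyink's transverse
integrand.

## Main results

* `Torus.tendstoUniformlyOn_transverseApprox_of_matrix_facts` — **the uniform transverse Eyink
  defect**: for a distributional Euler solution `(u,p)` on `T^d × (0,T)`, `d ≥ 2`, `u ∈ L³`,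
  `p ∈ L^{3/2}`, granted the two matrix-kernel facts of `NovackMatrixKernel` (both discharged in the
  tree), for every test function `ψ` supported in `(0,T)`,
  `∫₀ᵀ∫ D_T^{ε,φ}(u) ψ → D(u,p)(ψ)` as `ε → 0⁺` uniformly over spherically symmetric unit-ball
  mollifiers `φ` (`D(u,p) = Torus.energyFluxFunctional T u p`, Duchon–Robert's energy flux) — the
  `T`-half of `Torus.HasUniformEyinkDefect` (Eyink 2003, Thm. 1, `X = T`, uniform in `φ`).
* `Torus.hasFourFifthsLaw_of_pressure_fact` — **the accepted fact from the pressure fact alone, in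
  every dimension**: `exists_pressure_of_tendsto_L3 → HasDuchonRobertDefect.hasFourFifthsLaw`, using
  the tree's discharges `Torus.integral_kernelFlux_mul_eq_holds`, `Torus.symmTestField_identity_holds`,
  `Torus.integral_matKernelFlux_mul_eq_holds`,
  `Torus.IsDistributionalNSSolutionOn.matSymmTestField_identity_holds`, the 4/3 law
  `Torus.hasFourThirdsLaw_of_symmTestField_identity_of_pressure`, the identification of the limit with
  the given defect (`Torus.hasUniformDuchonRobertDefect_of_steps`, uniqueness of Duchon–Robert defects)
  and `Torus.HasFourThirdsLaw.hasFourFifthsLaw_of_uniformTransverse` (`EyinkUniformDefectTransverse`);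
  `d = 0, 1` from `EyinkUniformDefectOfEuler`.

## Proof of the uniform transverse limit (Eyink 2003, §2, with the excision at the origin removed)

Fix a radial unit-ball mollifier `φ`, `ε ∈ (0, ε₀)` and `ψ`. For `κ > 0` let
`φ̃_κ = φ(1 − χ_κ)/m_κ`, `m_κ = ∫ φ(1 − χ_κ)`; for small `κ` this is again a radial unit-ball
mollifier, and it vanishes on the ball of radius `κ/2`, so `EyinkBalanceOfMatrix` gives the scale-`ε`
balance `𝓔_T^{ε,φ̃_κ}(ψ) = (4(d−1)/d) ∫∫ D_T^{ε,φ̃_κ} ψ`, while `EyinkBalanceLimits` gives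
`|𝓔_T^{ε,φ̃_κ}(ψ) − (4(d−1)/d) D(u,p)(ψ)| < η` with `ε₀ = ε₀(η)` **independent of the mollifier**;
hence `|∫∫ D_T^{ε,φ̃_κ} ψ − D(u,p)(ψ)| < η d/(4(d−1))` for all small `κ`. Finally
`∫∫ D_T^{ε,φ̃_κ} ψ → ∫∫ D_T^{ε,φ} ψ` as `κ → 0⁺` at fixed `ε`: the pairing is additive and homogeneous
in the profile (§ Pairing: it is `c_T ∭ W_{φ,ε}(|ξ|) Q_T(ξ̂, δu) ψ` with an `L¹` radial weight,
`Torus.integrable_kernel_increment`), the masses `m_κ → 1`, and the remainder pairing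
`∫∫ D_T^{ε,φχ_κ} ψ → 0` because `∫ |W_{φχ_κ,ε}(|ξ|)| dξ → 0` (§ Remainder: dominated convergence, the
weight being bounded by `ε^{-d-1}(|Φ'| + C ε|ξ|⁻¹|Φ|)(|ξ|/ε) + 2ε^{-d}|ξ|⁻¹|Φ(|ξ|/ε)|`, integrable in
dimension `≥ 2`, and vanishing eventually off `ξ = 0`).

## References

* G. L. Eyink, *Local 4/5-law and energy dissipation anomaly in turbulence*, Nonlinearity 16 (2003)
  137–145 = arXiv:nlin/0208004, §2 Thm. 1, (uuT-eq), Cor. 1 ((en-T-eq), (T-eq)). [Eyink2003]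
* J. Duchon, R. Robert, Nonlinearity 13 (2000) 249–255, Prop. 2. [DuchonRobert2000]
* M. Novack, Nonlinearity 37 (2024) 095002, Thm. 1 (the unconditional laws, `d ≥ 2`). [Novack2024]
-/

noncomputable section

open MeasureTheory TopologicalSpace Set Function Filter Metric
open _root_.Topology
open scoped ENNReal NNReal Convolution ContDiff InnerProductSpace RealInnerProductSpace

namespace Literature.Analysis.FluidPDE.Torus

variable {d : Type*} [Fintype d]

/-! ## Smooth radial cut-offs and the excision of a profile at the origin -/

section Cutoff

/-- **The unit cut-off** `χ(η) = S((1 − |η|²)·(4/3))`-type profile read through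
`Torus.novackCutoff 1 (3/4)`: smooth, spherically symmetric, with values in `[0,1]`, equal to `1` on
the closed ball of radius `1/2` and to `0` off the open unit ball. [folklore] -/
def unitCutoff (η : EuclideanSpace ℝ d) : ℝ :=
  novackCutoff 1 (3 / 4) (‖η‖ ^ 2)

/-- **The cut-off at radius `κ`**, `χ_κ(ξ) = χ(ξ/κ)`. [folklore] -/
def cutoff (κ : ℝ) (ξ : EuclideanSpace ℝ d) : ℝ :=
  unitCutoff (κ⁻¹ • ξ)

/-- The unit cut-off is smooth. [folklore] -/
theorem contDiff_unitCutoff : ContDiff ℝ ∞ (unitCutoff : EuclideanSpace ℝ d → ℝ) :=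
  contDiff_comp_norm_sq (contDiff_novackCutoff 1 (3 / 4))

/-- The cut-off at radius `κ` is smooth. [folklore] -/
theorem contDiff_cutoff (κ : ℝ) : ContDiff ℝ ∞ (cutoff κ : EuclideanSpace ℝ d → ℝ) :=
  contDiff_unitCutoff.comp (contDiff_const_smul _)

/-- `0 ≤ χ_κ ≤ 1`. [folklore] -/
theorem cutoff_mem_Icc (κ : ℝ) (ξ : EuclideanSpace ℝ d) : cutoff κ ξ ∈ Icc (0 : ℝ) 1 :=
  novackCutoff_mem_Icc _ _ _

/-- `χ_κ` is spherically symmetric. [folklore] -/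
theorem cutoff_radial (κ : ℝ) (ξ η : EuclideanSpace ℝ d) (h : ‖ξ‖ = ‖η‖) : cutoff κ ξ = cutoff κ η := by
  simp only [cutoff, unitCutoff, norm_smul, h]

/-- `χ_κ(ξ) = 0` for `‖ξ‖ ≥ κ > 0`. [folklore] -/
theorem cutoff_eq_zero {κ : ℝ} (hκ : 0 < κ) {ξ : EuclideanSpace ℝ d} (hξ : κ ≤ ‖ξ‖) : cutoff κ ξ = 0 := by
  refine novackCutoff_eq_zero one_ne_zero (by norm_num) ?_
  rw [one_pow, norm_smul, norm_inv, Real.norm_eq_abs, abs_of_pos hκ]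
  have h1 : 1 ≤ κ⁻¹ * ‖ξ‖ := by rwa [le_inv_mul_iff₀ hκ, mul_one]
  nlinarith

/-- `χ_κ(ξ) = 1` for `‖ξ‖ ≤ κ/2`, `κ > 0`. [folklore] -/
theorem cutoff_eq_one {κ : ℝ} (hκ : 0 < κ) {ξ : EuclideanSpace ℝ d} (hξ : ‖ξ‖ ≤ κ / 2) : cutoff κ ξ = 1 := by
  refine novackCutoff_eq_one one_ne_zero (by norm_num) ?_
  rw [one_pow, norm_smul, norm_inv, Real.norm_eq_abs, abs_of_pos hκ]
  have h1 : κ⁻¹ * ‖ξ‖ ≤ 1 / 2 := by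
    rw [inv_mul_le_iff₀ hκ]; linarith
  have h0 : 0 ≤ κ⁻¹ * ‖ξ‖ := by positivity
  nlinarith

variable {φ : EuclideanSpace ℝ d → ℝ} {κ : ℝ}

/-- **The excised profile** `φ(1 − χ_κ)`: vanishes on the ball of radius `κ/2`. [folklore] -/
def excise (φ : EuclideanSpace ℝ d → ℝ) (κ : ℝ) (ξ : EuclideanSpace ℝ d) : ℝ :=
  φ ξ * (1 - cutoff κ ξ)

/-- **The remainder profile** `φ χ_κ`: supported in the closed ball of radius `κ`. [folklore] -/
def remainder (φ : EuclideanSpace ℝ d → ℝ) (κ : ℝ) (ξ : EuclideanSpace ℝ d) : ℝ :=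
  φ ξ * cutoff κ ξ

/-- `φ = φ(1 − χ_κ) + φχ_κ`. [folklore] -/
theorem excise_add_remainder (φ : EuclideanSpace ℝ d → ℝ) (κ : ℝ) (ξ : EuclideanSpace ℝ d) :
    excise φ κ ξ + remainder φ κ ξ = φ ξ := by
  simp only [excise, remainder]; ring

/-- The excised profile of a radial bump is a radial bump. [folklore] -/
theorem IsRadialBump.excise (hφ : IsRadialBump φ) (κ : ℝ) : IsRadialBump (excise φ κ) := by
  refine ⟨hφ.smooth.mul (contDiff_const.sub (contDiff_cutoff κ)), hφ.hasCompactSupport.mul_right, fun ξ η h => ?_⟩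
  simp only [Torus.excise, hφ.radial ξ η h, cutoff_radial κ ξ η h]

/-- The remainder profile of a radial bump is a radial bump. [folklore] -/
theorem IsRadialBump.remainder (hφ : IsRadialBump φ) (κ : ℝ) : IsRadialBump (remainder φ κ) := by
  refine ⟨hφ.smooth.mul (contDiff_cutoff κ), hφ.hasCompactSupport.mul_right, fun ξ η h => ?_⟩
  simp only [Torus.remainder, hφ.radial ξ η h, cutoff_radial κ ξ η h]

/-- The excised profile is nonnegative if `φ` is. [folklore] -/
theorem excise_nonneg (hφ0 : ∀ ξ, 0 ≤ φ ξ) (κ : ℝ) (ξ : EuclideanSpace ℝ d) : 0 ≤ excise φ κ ξ :=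
  mul_nonneg (hφ0 ξ) (sub_nonneg.2 (cutoff_mem_Icc κ ξ).2)

/-- The remainder profile is nonnegative if `φ` is. [folklore] -/
theorem remainder_nonneg (hφ0 : ∀ ξ, 0 ≤ φ ξ) (κ : ℝ) (ξ : EuclideanSpace ℝ d) : 0 ≤ remainder φ κ ξ :=
  mul_nonneg (hφ0 ξ) (cutoff_mem_Icc κ ξ).1

/-- The excised profile is dominated by `φ ≥ 0`. [folklore] -/
theorem excise_le (hφ0 : ∀ ξ, 0 ≤ φ ξ) (κ : ℝ) (ξ : EuclideanSpace ℝ d) : excise φ κ ξ ≤ φ ξ := by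
  have := (cutoff_mem_Icc κ ξ).1
  unfold excise
  nlinarith [hφ0 ξ]

/-- The remainder profile is dominated by `φ ≥ 0`. [folklore] -/
theorem remainder_le (hφ0 : ∀ ξ, 0 ≤ φ ξ) (κ : ℝ) (ξ : EuclideanSpace ℝ d) : remainder φ κ ξ ≤ φ ξ := by
  have := (cutoff_mem_Icc κ ξ).2
  unfold remainder
  nlinarith [hφ0 ξ]

/-- Both profiles vanish wherever `φ` does. [folklore] -/
theorem excise_eq_zero_of (κ : ℝ) {ξ : EuclideanSpace ℝ d} (h : φ ξ = 0) : excise φ κ ξ = 0 := by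
  simp [excise, h]

/-- Both profiles vanish wherever `φ` does. [folklore] -/
theorem remainder_eq_zero_of (κ : ℝ) {ξ : EuclideanSpace ℝ d} (h : φ ξ = 0) : remainder φ κ ξ = 0 := by
  simp [remainder, h]

/-- The excised profile vanishes on the open ball of radius `κ/2` (`κ > 0`). [folklore] -/
theorem excise_eq_zero_of_lt (hκ : 0 < κ) {ξ : EuclideanSpace ℝ d} (hξ : ‖ξ‖ < κ / 2) : excise φ κ ξ = 0 := by
  simp [excise, cutoff_eq_one hκ hξ.le]

/-- The remainder profile vanishes off the open ball of radius `κ` (`κ > 0`). [folklore] -/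
theorem remainder_eq_zero_of_le (hκ : 0 < κ) {ξ : EuclideanSpace ℝ d} (hξ : κ ≤ ‖ξ‖) : remainder φ κ ξ = 0 := by
  simp [remainder, cutoff_eq_zero hκ hξ]

/-- For `ξ ≠ 0` the remainder profile vanishes for all small `κ`: eventually along `κ → 0⁺`,
`(φχ_κ)(ξ) = 0`. [folklore] -/
theorem eventually_remainder_eq_zero {ξ : EuclideanSpace ℝ d} (hξ : ξ ≠ 0) :
    ∀ᶠ κ in 𝓝[>] (0 : ℝ), remainder φ κ ξ = 0 := by
  have hn : 0 < ‖ξ‖ := norm_pos_iff.2 hξ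
  filter_upwards [Ioo_mem_nhdsGT hn] with κ hκ
  exact remainder_eq_zero_of_le hκ.1 hκ.2.le

/-- **The mass of the remainder tends to zero**: `∫ φχ_κ → 0` as `κ → 0⁺` for an integrable
`φ ≥ 0` (dominated convergence). [folklore] -/
theorem tendsto_integral_remainder [Nonempty d] (hφi : Integrable φ volume) (hφ0 : ∀ ξ, 0 ≤ φ ξ) (hφc : Continuous φ) :
    Tendsto (fun κ => ∫ ξ, remainder φ κ ξ) (𝓝[>] (0 : ℝ)) (𝓝 0) := by
  have h0ae : ∀ᵐ ξ : EuclideanSpace ℝ d ∂volume, ξ ≠ 0 := by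
    have h : ({(0 : EuclideanSpace ℝ d)}ᶜ : Set (EuclideanSpace ℝ d)) ∈ ae (volume : Measure (EuclideanSpace ℝ d)) :=
      compl_mem_ae_iff.2 (measure_singleton 0)
    filter_upwards [h] with ξ hξ
    simpa using hξ
  have hlim : ∀ᵐ ξ : EuclideanSpace ℝ d ∂volume, Tendsto (fun κ => remainder φ κ ξ) (𝓝[>] (0 : ℝ)) (𝓝 0) := by
    filter_upwards [h0ae] with ξ hξ
    exact tendsto_const_nhds.congr' ((eventually_remainder_eq_zero hξ).mono fun κ h => h.symm)
  have hmeas : ∀ κ, AEStronglyMeasurable (fun ξ => remainder φ κ ξ) volume := fun κ =>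
    (hφc.mul (contDiff_cutoff κ).continuous).aestronglyMeasurable
  have hbound : ∀ κ, ∀ᵐ ξ : EuclideanSpace ℝ d ∂volume, ‖remainder φ κ ξ‖ ≤ φ ξ := fun κ =>
    ae_of_all _ fun ξ => by
      rw [Real.norm_eq_abs, abs_of_nonneg (remainder_nonneg hφ0 κ ξ)]
      exact remainder_le hφ0 κ ξ
  have := tendsto_integral_filter_of_dominated_convergence (bound := φ)
    (Eventually.of_forall hmeas) (Eventually.of_forall hbound) hφi hlim
  simpa using this

/-- **The mass of the excised profile tends to the mass of `φ`** as `κ → 0⁺`. [folklore] -/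
theorem tendsto_integral_excise [Nonempty d] (hφi : Integrable φ volume) (hφ0 : ∀ ξ, 0 ≤ φ ξ) (hφc : Continuous φ) :
    Tendsto (fun κ => ∫ ξ, excise φ κ ξ) (𝓝[>] (0 : ℝ)) (𝓝 (∫ ξ, φ ξ)) := by
  have e : ∀ κ, ∫ ξ, excise φ κ ξ = (∫ ξ, φ ξ) - ∫ ξ, remainder φ κ ξ := fun κ => by
    have hr : Integrable (fun ξ => remainder φ κ ξ) volume := by
      refine hφi.mono ((hφc.mul (contDiff_cutoff κ).continuous).aestronglyMeasurable) (ae_of_all _ fun ξ => ?_)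
      rw [Real.norm_eq_abs, abs_of_nonneg (remainder_nonneg hφ0 κ ξ), Real.norm_eq_abs, abs_of_nonneg (hφ0 ξ)]
      exact remainder_le hφ0 κ ξ
    rw [← integral_sub hφi hr]
    exact integral_congr_ae (ae_of_all _ fun ξ => by simp [excise, remainder]; ring)
  simp_rw [e]
  simpa using (tendsto_const_nhds (x := ∫ ξ, φ ξ)).sub (tendsto_integral_remainder hφi hφ0 hφc)

end Cutoff

/-! ## The transverse pairing `∫₀ᵀ∫ D_T^{ε,φ} ψ` as a triple integral; additivity and homogeneity in `φ` -/

section Pairing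

variable [DecidableEq d] [Nonempty d] {T ε Cψ : ℝ} {u : ℝ → UnitAddTorus d → EuclideanSpace ℝ d} {ψ : ℝ → UnitAddTorus d → ℝ}
  {φ φ₁ φ₂ : EuclideanSpace ℝ d → ℝ}

variable (d) in
/-- **The radial weight of Eyink's transverse integrand** at scale `ε`: with the profile
`Φ(r) = φ(r e₀)` along the unit vector `e₀ = unitVec d`,
`W_{φ,ε}(r) = ε^{-d}ε⁻¹Φ'(r/ε) − r⁻¹·2ε^{-d}Φ(r/ε)`, so that
`{∇φ^ε·δ |δ_T|² − (2/|ξ|)φ^ε δ_L|δ_T|²} = W_{φ,ε}(|ξ|) Q_T(ξ̂, δ)` with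
`Q_T(ω,v) = ⟪v,o⟫|v − ⟪v,o⟫ω|²` (Eyink 2003, proof of Cor. 1, (en-T-eq)). [cite: Eyink2003, §2 Cor. 1] -/
def transverseWeight (φ : EuclideanSpace ℝ d → ℝ) (ε r : ℝ) : ℝ :=
  (ε ^ Fintype.card d)⁻¹ * (ε⁻¹ * deriv (fun s : ℝ => φ (s • unitVec d)) (ε⁻¹ * r)) -
    r⁻¹ * (2 * ((ε ^ Fintype.card d)⁻¹ * φ ((ε⁻¹ * r) • unitVec d)))

omit [DecidableEq d] [Nonempty d] in
/-- Profiles along a line of a smooth function: `s ↦ φ(s e)` is `C¹` with continuous derivative,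
and vanishes (with its derivative) for `|s| > R` when `φ` vanishes off the ball of radius `R`
(`‖e‖ = 1`). [folklore] -/
theorem lineProfile_facts {φ : EuclideanSpace ℝ d → ℝ} (hφ : ContDiff ℝ ∞ φ) {e : EuclideanSpace ℝ d}
    (he : ‖e‖ = 1) {R : ℝ} (hR : ∀ ξ, R < ‖ξ‖ → φ ξ = 0) :
    ContDiff ℝ 1 (fun s : ℝ => φ (s • e)) ∧ Continuous (deriv fun s : ℝ => φ (s • e)) ∧
      (∀ s, R < |s| → φ (s • e) = 0) ∧ ∀ s, R < s → deriv (fun s : ℝ => φ (s • e)) s = 0 := by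
  have h1 : ContDiff ℝ 1 (fun s : ℝ => φ (s • e)) := (hφ.of_le (by simp)).comp (contDiff_id.smul contDiff_const)
  have hsupp : ∀ s, R < |s| → φ (s • e) = 0 := fun s hs =>
    hR _ (by rw [norm_smul, he, mul_one, Real.norm_eq_abs]; exact hs)
  exact ⟨h1, h1.continuous_deriv le_rfl, hsupp, fun s hs =>
    deriv_eq_zero_of_forall_gt (fun s' hs' => hsupp s' (hs'.trans_le (le_abs_self s'))) hs⟩

/-- **The transverse weight is in `L¹(ℝ^d)`** (as a function of `|ξ|`) for a radial bump `φ`,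
`ε > 0` and `d ≥ 2` (the `1/|ξ|` singularity). [folklore] -/
theorem integrable_transverseWeight (hn2 : 2 ≤ Fintype.card d) (hφ : IsRadialBump φ) (hε : 0 < ε) :
    Integrable (fun ξ : EuclideanSpace ℝ d => transverseWeight d φ ε ‖ξ‖) volume := by
  obtain ⟨R, -, hR⟩ := hφ.exists_eq_zero
  have hR' : ∀ ξ : EuclideanSpace ℝ d, R < ‖ξ‖ → φ ξ = 0 := fun ξ hξ => hR ξ hξ.le
  set n : ℕ := Fintype.card d with hn
  set Φ : ℝ → ℝ := fun s => φ (s • unitVec d) with hΦ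
  obtain ⟨-, hΦ'c₀, hΦsupp₀, hΦ'supp₀⟩ := lineProfile_facts hφ.smooth (norm_unitVec (d := d)) hR'
  have hΦ'c : Continuous (deriv Φ) := hΦ'c₀
  have hΦsupp : ∀ s, R < |s| → Φ s = 0 := hΦsupp₀
  have hΦ'supp : ∀ s, R < s → deriv Φ s = 0 := hΦ'supp₀
  have hΦc : Continuous Φ := hφ.smooth.continuous.comp (continuous_id.smul continuous_const)
  have hkint : Integrable (fun ξ : EuclideanSpace ℝ d => (ε ^ n)⁻¹ * (ε⁻¹ * deriv Φ (ε⁻¹ * ‖ξ‖))) volume := by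
    have hkcont : Continuous fun r : ℝ => (ε ^ n)⁻¹ * (ε⁻¹ * deriv Φ (ε⁻¹ * r)) := by fun_prop
    refine (hkcont.comp continuous_norm).integrable_of_hasCompactSupport ?_
    refine HasCompactSupport.intro (isCompact_closedBall (0 : EuclideanSpace ℝ d) (ε * |R|)) fun ξ hξ => ?_
    have hξ' : ε * |R| < ‖ξ‖ := by simpa [dist_zero_right] using hξ
    show (ε ^ n)⁻¹ * (ε⁻¹ * deriv Φ (ε⁻¹ * ‖ξ‖)) = 0
    rw [hΦ'supp _ ?_, mul_zero, mul_zero]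
    rw [← div_eq_inv_mul, lt_div_iff₀ hε]
    calc R * ε ≤ |R| * ε := by gcongr; exact le_abs_self R
      _ = ε * |R| := mul_comm _ _
      _ < ‖ξ‖ := hξ'
  have hmint : Integrable (fun ξ : EuclideanSpace ℝ d => ‖ξ‖⁻¹ * (2 * ((ε ^ n)⁻¹ * Φ (ε⁻¹ * ‖ξ‖)))) volume := by
    have hX : Continuous fun y : ℝ => 2 * ((ε ^ n)⁻¹ * Φ (ε⁻¹ * y)) := by fun_prop
    refine integrable_inv_norm_mul_radial hn2 (R := ε * |R|) hX fun r hr => ?_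
    show 2 * ((ε ^ n)⁻¹ * Φ (ε⁻¹ * r)) = 0
    rw [hΦsupp _ ?_, mul_zero, mul_zero]
    rw [abs_mul, abs_inv, abs_of_pos hε, ← div_eq_inv_mul, lt_div_iff₀ hε]
    calc R * ε ≤ |R| * ε := by gcongr; exact le_abs_self R
      _ = ε * |R| := mul_comm _ _
      _ < |r| := hr
  have e : (fun ξ : EuclideanSpace ℝ d => transverseWeight d φ ε ‖ξ‖) = fun ξ =>
      (ε ^ n)⁻¹ * (ε⁻¹ * deriv Φ (ε⁻¹ * ‖ξ‖)) - ‖ξ‖⁻¹ * (2 * ((ε ^ n)⁻¹ * Φ (ε⁻¹ * ‖ξ‖))) := by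
    funext ξ
    rfl
  rw [e]
  exact hkint.sub hmint

/-- Eyink's transverse integrand in weight form:
`{…}(ξ) = W_{φ,ε}(|ξ|) Q_T(ξ̂, δw(x;ξ))` for a smooth radial `φ`. [cite: Eyink2003, §2 Cor. 1] -/
theorem eyinkTransverseIntegrand_eq_weight (hφ : IsRadialBump φ) (ε : ℝ)
    (w : UnitAddTorus d → EuclideanSpace ℝ d) (x : UnitAddTorus d) (ξ : EuclideanSpace ℝ d) :
    eyinkTransverseIntegrand φ ε w x ξ =
      transverseWeight d φ ε ‖ξ‖ *
        (⟪increment w ξ x, ‖ξ‖⁻¹ • ξ⟫ * ‖increment w ξ x - ⟪increment w ξ x, ‖ξ‖⁻¹ • ξ⟫ • (‖ξ‖⁻¹ • ξ)‖ ^ 2) := by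
  rw [(eyink_integrands_eq_kernel hφ.smooth hφ.radial norm_unitVec ε w x ξ).2, transverseWeight, smul_smul]
  ring

/-- **The transverse pairing as a triple integral.** For a radial bump `φ`, `ε > 0`, `d ≥ 2`,
`u ∈ L³((0,T) × T^d)` jointly measurable and a bounded measurable `ψ`: the function
`((t,x),ξ) ↦ W_{φ,ε}(|ξ|) Q_T(ξ̂, δu(t,x;ξ)) ψ(t,x)` is integrable on `((0,T) × T^d) × ℝ^d`, and
`∫₀ᵀ∫ D_T^{ε,φ}(u) ψ = (d/(4(d−1))) ∭ W Q_T ψ` (Fubini; `Torus.integrable_kernel_increment`). [cite: Eyink2003, §2 Cor. 1] -/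
theorem integral_transverseApprox_eq_triple (hn2 : 2 ≤ Fintype.card d) (hφ : IsRadialBump φ)
    (hu : AEStronglyMeasurable (uncurry u) ((volume.restrict (Ioo 0 T)).prod volume))
    (hu3 : ∫⁻ q, ‖uncurry u q‖ₑ ^ 3 ∂((volume.restrict (Ioo 0 T)).prod volume) < ⊤)
    (hψm : AEStronglyMeasurable (uncurry ψ) ((volume.restrict (Ioo 0 T)).prod volume))
    (hψb : ∀ t x, |ψ t x| ≤ Cψ) (hε : 0 < ε) :
    Integrable (fun q : (ℝ × UnitAddTorus d) × EuclideanSpace ℝ d =>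
        transverseWeight d φ ε ‖q.2‖ *
          (⟪increment (u q.1.1) q.2 q.1.2, ‖q.2‖⁻¹ • q.2⟫ *
            ‖increment (u q.1.1) q.2 q.1.2 - ⟪increment (u q.1.1) q.2 q.1.2, ‖q.2‖⁻¹ • q.2⟫ • (‖q.2‖⁻¹ • q.2)‖ ^ 2) *
          ψ q.1.1 q.1.2)
        (((volume.restrict (Ioo 0 T)).prod volume).prod volume) ∧
      ∫ t in Ioo 0 T, ∫ x, eyinkTransverseApprox φ ε (u t) x * ψ t x =
        eyinkTransverseConst d * ∫ q, transverseWeight d φ ε ‖q.2‖ *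
          (⟪increment (u q.1.1) q.2 q.1.2, ‖q.2‖⁻¹ • q.2⟫ *
            ‖increment (u q.1.1) q.2 q.1.2 - ⟪increment (u q.1.1) q.2 q.1.2, ‖q.2‖⁻¹ • q.2⟫ • (‖q.2‖⁻¹ • q.2)‖ ^ 2) *
          ψ q.1.1 q.1.2 ∂(((volume.restrict (Ioo 0 T)).prod volume).prod volume) := by
  set μp : Measure (ℝ × UnitAddTorus d) := (volume.restrict (Ioo 0 T)).prod volume with hμp
  have hQTc : Continuous (uncurry fun (o v : EuclideanSpace ℝ d) => ⟪v, o⟫ * ‖v - ⟪v, o⟫ • o‖ ^ 2) :=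
    continuous_cubicFormT
  have hQT : ∀ o v : EuclideanSpace ℝ d, ‖o‖ ≤ 1 →
      |(fun (o v : EuclideanSpace ℝ d) => ⟪v, o⟫ * ‖v - ⟪v, o⟫ • o‖ ^ 2) o v| ≤ 4 * ‖v‖ ^ 3 :=
    fun o v ho => abs_cubicFormT_le v ho
  have hF := integrable_kernel_increment hu hu3 hψm hψb hQTc (by norm_num) hQT (integrable_transverseWeight hn2 hφ hε)
  refine ⟨hF, ?_⟩
  -- pointwise weight form
  have hpt : ∀ (t : ℝ) (x : UnitAddTorus d), eyinkTransverseApprox φ ε (u t) x * ψ t x =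
      eyinkTransverseConst d * ∫ ξ, transverseWeight d φ ε ‖ξ‖ *
        (⟪increment (u t) ξ x, ‖ξ‖⁻¹ • ξ⟫ * ‖increment (u t) ξ x - ⟪increment (u t) ξ x, ‖ξ‖⁻¹ • ξ⟫ • (‖ξ‖⁻¹ • ξ)‖ ^ 2) *
        ψ t x := by
    intro t x
    rw [eyinkTransverseApprox, mul_assoc, ← integral_mul_const]
    congr 1
    exact integral_congr_ae (ae_of_all _ fun ξ => by simp only; rw [eyinkTransverseIntegrand_eq_weight hφ])
  -- the `ξ`-marginal is integrable
  have hm := hF.integral_prod_left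
  dsimp only at hm
  have e1 : ∫ t in Ioo 0 T, ∫ x, eyinkTransverseApprox φ ε (u t) x * ψ t x =
      ∫ t in Ioo 0 T, ∫ x, eyinkTransverseConst d * ∫ ξ, transverseWeight d φ ε ‖ξ‖ *
        (⟪increment (u t) ξ x, ‖ξ‖⁻¹ • ξ⟫ * ‖increment (u t) ξ x - ⟪increment (u t) ξ x, ‖ξ‖⁻¹ • ξ⟫ • (‖ξ‖⁻¹ • ξ)‖ ^ 2) *
        ψ t x := by
    refine setIntegral_congr_fun measurableSet_Ioo fun t _ => ?_
    exact integral_congr_ae (ae_of_all _ fun x => hpt t x)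
  have e3 : ∫ t in Ioo 0 T, ∫ x, ∫ ξ, transverseWeight d φ ε ‖ξ‖ *
        (⟪increment (u t) ξ x, ‖ξ‖⁻¹ • ξ⟫ * ‖increment (u t) ξ x - ⟪increment (u t) ξ x, ‖ξ‖⁻¹ • ξ⟫ • (‖ξ‖⁻¹ • ξ)‖ ^ 2) *
        ψ t x =
      ∫ q, (∫ ξ, transverseWeight d φ ε ‖ξ‖ *
        (⟪increment (u q.1) ξ q.2, ‖ξ‖⁻¹ • ξ⟫ * ‖increment (u q.1) ξ q.2 - ⟪increment (u q.1) ξ q.2, ‖ξ‖⁻¹ • ξ⟫ • (‖ξ‖⁻¹ • ξ)‖ ^ 2) *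
        ψ q.1 q.2) ∂μp := by
    rw [integral_prod _ hm]
  have e4 : ∫ q, (∫ ξ, transverseWeight d φ ε ‖ξ‖ *
        (⟪increment (u q.1) ξ q.2, ‖ξ‖⁻¹ • ξ⟫ * ‖increment (u q.1) ξ q.2 - ⟪increment (u q.1) ξ q.2, ‖ξ‖⁻¹ • ξ⟫ • (‖ξ‖⁻¹ • ξ)‖ ^ 2) *
        ψ q.1 q.2) ∂μp =
      ∫ q, transverseWeight d φ ε ‖q.2‖ *
          (⟪increment (u q.1.1) q.2 q.1.2, ‖q.2‖⁻¹ • q.2⟫ *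
            ‖increment (u q.1.1) q.2 q.1.2 - ⟪increment (u q.1.1) q.2 q.1.2, ‖q.2‖⁻¹ • q.2⟫ • (‖q.2‖⁻¹ • q.2)‖ ^ 2) *
          ψ q.1.1 q.1.2 ∂(μp.prod volume) := by
    rw [integral_prod _ hF]
  rw [e1]
  simp_rw [integral_const_mul]
  rw [e3, e4]

/-- Additivity of the transverse weight in the profile (smooth profiles). [folklore] -/
theorem transverseWeight_add (h₁ : ContDiff ℝ ∞ φ₁) (h₂ : ContDiff ℝ ∞ φ₂) (ε r : ℝ) :
    transverseWeight d (fun ξ => φ₁ ξ + φ₂ ξ) ε r = transverseWeight d φ₁ ε r + transverseWeight d φ₂ ε r := by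
  have hd₁ : Differentiable ℝ fun s : ℝ => φ₁ (s • unitVec d) :=
    (h₁.comp (contDiff_id.smul contDiff_const)).differentiable (by simp)
  have hd₂ : Differentiable ℝ fun s : ℝ => φ₂ (s • unitVec d) :=
    (h₂.comp (contDiff_id.smul contDiff_const)).differentiable (by simp)
  simp only [transverseWeight]
  rw [show (fun s : ℝ => φ₁ (s • unitVec d) + φ₂ (s • unitVec d)) =
      (fun s : ℝ => φ₁ (s • unitVec d)) + fun s : ℝ => φ₂ (s • unitVec d) from rfl,
    deriv_add (hd₁ _) (hd₂ _)]
  ring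

/-- Homogeneity of the transverse weight in the profile. [folklore] -/
theorem transverseWeight_const_mul (c : ℝ) (φ : EuclideanSpace ℝ d → ℝ) (ε r : ℝ) :
    transverseWeight d (fun ξ => c * φ ξ) ε r = c * transverseWeight d φ ε r := by
  simp only [transverseWeight]
  rw [show (fun s : ℝ => c * φ (s • unitVec d)) = fun s => c * (fun s : ℝ => φ (s • unitVec d)) s from rfl,
    deriv_const_mul_field]
  ring

/-- **Additivity of the transverse pairing in the profile**: for radial bumps `φ₁`, `φ₂`,
`∫∫ D_T^{ε,φ₁+φ₂} ψ = ∫∫ D_T^{ε,φ₁} ψ + ∫∫ D_T^{ε,φ₂} ψ` (`d ≥ 2`; triple form). [folklore] -/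
theorem integral_transverseApprox_add (hn2 : 2 ≤ Fintype.card d) (hφ₁ : IsRadialBump φ₁) (hφ₂ : IsRadialBump φ₂)
    (hu : AEStronglyMeasurable (uncurry u) ((volume.restrict (Ioo 0 T)).prod volume))
    (hu3 : ∫⁻ q, ‖uncurry u q‖ₑ ^ 3 ∂((volume.restrict (Ioo 0 T)).prod volume) < ⊤)
    (hψm : AEStronglyMeasurable (uncurry ψ) ((volume.restrict (Ioo 0 T)).prod volume))
    (hψb : ∀ t x, |ψ t x| ≤ Cψ) (hε : 0 < ε) :
    ∫ t in Ioo 0 T, ∫ x, eyinkTransverseApprox (fun ξ => φ₁ ξ + φ₂ ξ) ε (u t) x * ψ t x =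
      (∫ t in Ioo 0 T, ∫ x, eyinkTransverseApprox φ₁ ε (u t) x * ψ t x) +
        ∫ t in Ioo 0 T, ∫ x, eyinkTransverseApprox φ₂ ε (u t) x * ψ t x := by
  have h12 : IsRadialBump fun ξ => φ₁ ξ + φ₂ ξ :=
    ⟨hφ₁.smooth.add hφ₂.smooth, hφ₁.hasCompactSupport.add hφ₂.hasCompactSupport,
      fun ξ η h => by rw [hφ₁.radial ξ η h, hφ₂.radial ξ η h]⟩
  obtain ⟨hF, e⟩ := integral_transverseApprox_eq_triple hn2 h12 hu hu3 hψm hψb hε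
  obtain ⟨hF₁, e₁⟩ := integral_transverseApprox_eq_triple hn2 hφ₁ hu hu3 hψm hψb hε
  obtain ⟨hF₂, e₂⟩ := integral_transverseApprox_eq_triple hn2 hφ₂ hu hu3 hψm hψb hε
  rw [e, e₁, e₂, ← mul_add, ← integral_add hF₁ hF₂]
  congr 1
  refine integral_congr_ae (ae_of_all _ fun q => ?_)
  simp only [transverseWeight_add hφ₁.smooth hφ₂.smooth]
  ring

omit [DecidableEq d] [Nonempty d] in
/-- **Homogeneity of the transverse integrand in the profile**: `D_T`-integrand of `c φ` is `c`
times that of `φ` (smooth `φ`; no integrability needed). [folklore] -/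
theorem eyinkTransverseIntegrand_const_mul (hφ : ContDiff ℝ ∞ φ) (c ε : ℝ)
    (w : UnitAddTorus d → EuclideanSpace ℝ d) (x : UnitAddTorus d) (ξ : EuclideanSpace ℝ d) :
    eyinkTransverseIntegrand (fun η => c * φ η) ε w x ξ = c * eyinkTransverseIntegrand φ ε w x ξ := by
  have hsc : (FluidPDE.mollifierScale ε fun η => c * φ η) = fun η => c * FluidPDE.mollifierScale ε φ η := by
    funext η; simp only [FluidPDE.mollifierScale_apply]; ring
  have hdiff : DifferentiableAt ℝ (FluidPDE.mollifierScale ε φ) ξ := by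
    have : ContDiff ℝ ∞ (FluidPDE.mollifierScale ε φ) := contDiff_const.mul (hφ.comp (contDiff_const_smul _))
    exact (this.differentiable (by simp)).differentiableAt
  have hgrad : gradient (FluidPDE.mollifierScale ε fun η => c * φ η) ξ = c • gradient (FluidPDE.mollifierScale ε φ) ξ := by
    rw [hsc, gradient, gradient, fderiv_const_mul hdiff, map_smul]
  rw [eyinkTransverseIntegrand, eyinkTransverseIntegrand, hgrad, hsc, real_inner_smul_left]
  simp only
  ring

omit [DecidableEq d] [Nonempty d] in
/-- **Homogeneity of the transverse pairing**: `∫∫ D_T^{ε,cφ} ψ = c ∫∫ D_T^{ε,φ} ψ`. [folklore] -/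
theorem integral_transverseApprox_const_mul (hφ : ContDiff ℝ ∞ φ) (c ε : ℝ) :
    ∫ t in Ioo 0 T, ∫ x, eyinkTransverseApprox (fun η => c * φ η) ε (u t) x * ψ t x =
      c * ∫ t in Ioo 0 T, ∫ x, eyinkTransverseApprox φ ε (u t) x * ψ t x := by
  rw [← integral_const_mul]
  refine setIntegral_congr_fun measurableSet_Ioo fun t _ => ?_
  rw [← integral_const_mul]
  refine integral_congr_ae (ae_of_all _ fun x => ?_)
  simp only [eyinkTransverseApprox]
  rw [show (∫ ξ, eyinkTransverseIntegrand (fun η => c * φ η) ε (u t) x ξ) =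
      c * ∫ ξ, eyinkTransverseIntegrand φ ε (u t) x ξ by
    rw [← integral_const_mul]
    exact integral_congr_ae (ae_of_all _ fun ξ => eyinkTransverseIntegrand_const_mul hφ c ε (u t) x ξ)]
  ring

end Pairing

/-! ## The remainder pairing vanishes as `κ → 0⁺` (fixed `ε`) -/

section Remainder

variable [DecidableEq d] [Nonempty d] {T ε Cψ : ℝ} {u : ℝ → UnitAddTorus d → EuclideanSpace ℝ d}
  {ψ : ℝ → UnitAddTorus d → ℝ} {φ : EuclideanSpace ℝ d → ℝ}

omit [DecidableEq d] [Nonempty d] in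
/-- A function vanishing on a neighbourhood has derivative zero there. [folklore] -/
theorem deriv_eq_zero_of_eventuallyEq_zero {f : ℝ → ℝ} {s : ℝ} (h : f =ᶠ[𝓝 s] fun _ => 0) : deriv f s = 0 := by
  rw [h.deriv_eq]; exact deriv_const s 0

/-- **The line profile of the cut-off** `X(t) = χ(t e₀)`: smooth, with bounded derivative, and
`X ≡ 0` on `|t| > 1`... precisely: `χ_κ(s e₀) = X(κ⁻¹ s)`, `X = 0` for `1 ≤ |t|`. [folklore] -/
theorem cutoffLine_facts :
    ContDiff ℝ ∞ (fun t : ℝ => unitCutoff (t • unitVec d)) ∧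
      (∃ CX : ℝ, 0 ≤ CX ∧ ∀ t, |deriv (fun t : ℝ => unitCutoff (t • unitVec d)) t| ≤ CX) ∧
      (∀ κ s : ℝ, cutoff κ (s • unitVec d) = (fun t : ℝ => unitCutoff (t • unitVec d)) (κ⁻¹ * s)) ∧
      ∀ t : ℝ, 1 ≤ |t| → (fun t : ℝ => unitCutoff (t • unitVec d)) t = 0 := by
  set X : ℝ → ℝ := fun t => unitCutoff (t • unitVec d) with hX
  have hXs : ContDiff ℝ ∞ X := contDiff_unitCutoff.comp (contDiff_id.smul contDiff_const)
  have hX0 : ∀ t : ℝ, 1 ≤ |t| → X t = 0 := fun t ht => by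
    have h := cutoff_eq_zero (d := d) one_pos (ξ := t • unitVec d) (by rw [norm_smul, norm_unitVec, mul_one, Real.norm_eq_abs]; exact ht)
    simpa [cutoff, hX] using h
  -- the derivative is continuous with compact support, hence bounded
  have hdc : Continuous (deriv X) := hXs.continuous_deriv (by simp)
  have hds : HasCompactSupport (deriv X) := by
    refine HasCompactSupport.intro (isCompact_Icc (a := -1) (b := 1)) fun t ht => ?_
    refine deriv_eq_zero_of_eventuallyEq_zero ?_
    have hopen : IsOpen {t : ℝ | 1 < |t|} := isOpen_lt continuous_const continuous_abs
    have ht' : 1 < |t| := by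
      simp only [mem_Icc, not_and_or, not_le] at ht
      rcases ht with ht | ht
      · calc (1 : ℝ) < -t := by linarith
          _ ≤ |t| := neg_le_abs t
      · exact ht.trans_le (le_abs_self t)
    filter_upwards [hopen.mem_nhds ht'] with t' ht''
    exact hX0 t' (le_of_lt ht'')
  obtain ⟨CX, hCX⟩ := hdc.bounded_above_of_compact_support hds
  refine ⟨hXs, ⟨max CX 0, le_max_right _ _, fun t => ?_⟩, fun κ s => ?_, hX0⟩
  · exact ((Real.norm_eq_abs _).symm.le.trans (hCX t)).trans (le_max_left _ _)
  · simp only [cutoff, hX, smul_smul]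

/-- **The `L¹` norm of the transverse weight of the remainder vanishes as `κ → 0⁺`** (fixed
`ε > 0`, `d ≥ 2`): `∫ |W_{φχ_κ,ε}(|ξ|)| dξ → 0`, by dominated convergence — the weight vanishes
eventually off `ξ = 0`, and `|W_{φχ_κ,ε}(|ξ|)| ≤ ε^{-d-1}(|Φ'| + C_X ε|ξ|⁻¹|Φ|)(|ξ|/ε) + 2ε^{-d}|ξ|⁻¹|Φ(|ξ|/ε)|`
uniformly in `κ` (`κ⁻¹ ≤ |s|⁻¹` on the support of `χ_κ'`). [folklore] -/
theorem tendsto_integral_abs_transverseWeight_remainder (hn2 : 2 ≤ Fintype.card d) (hφ : IsRadialBump φ)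
    (hε : 0 < ε) :
    Tendsto (fun κ => ∫ ξ : EuclideanSpace ℝ d, |transverseWeight d (remainder φ κ) ε ‖ξ‖|) (𝓝[>] (0 : ℝ)) (𝓝 0) := by
  obtain ⟨R, -, hR⟩ := hφ.exists_eq_zero
  have hR' : ∀ ξ : EuclideanSpace ℝ d, R < ‖ξ‖ → φ ξ = 0 := fun ξ hξ => hR ξ hξ.le
  set n : ℕ := Fintype.card d with hn
  set e₀ : EuclideanSpace ℝ d := unitVec d with he₀def
  have he₀ : ‖e₀‖ = 1 := norm_unitVec
  set Φ : ℝ → ℝ := fun s => φ (s • e₀) with hΦ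
  obtain ⟨hΦ1₀, hΦ'c₀, hΦsupp₀, hΦ'supp₀⟩ := lineProfile_facts hφ.smooth he₀ hR'
  have hΦ1 : ContDiff ℝ 1 Φ := hΦ1₀
  have hΦ'c : Continuous (deriv Φ) := hΦ'c₀
  have hΦsupp : ∀ s, R < |s| → Φ s = 0 := hΦsupp₀
  have hΦc : Continuous Φ := hφ.smooth.continuous.comp (continuous_id.smul continuous_const)
  have hΦd : ∀ s, HasDerivAt Φ (deriv Φ s) s := fun s => ((hΦ1.differentiable one_ne_zero) s).hasDerivAt
  obtain ⟨hXs, ⟨CX, hCX0, hCX⟩, hXκ, hX0⟩ := cutoffLine_facts (d := d)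
  set X : ℝ → ℝ := fun t => unitCutoff (t • unitVec d) with hXdef
  have hXd : ∀ t, HasDerivAt X (deriv X t) t := fun t => ((hXs.differentiable (by simp)) t).hasDerivAt
  have hXb : ∀ t, |X t| ≤ 1 := fun t => by
    have h := cutoff_mem_Icc (d := d) 1 (t • unitVec d)
    simp only [cutoff, inv_one, one_smul] at h
    rw [abs_of_nonneg h.1]; exact h.2
  -- the line profile of the remainder and its derivative
  have hrem : ∀ κ s, remainder φ κ (s • e₀) = Φ s * X (κ⁻¹ * s) := fun κ s => by
    simp only [remainder, hΦ, he₀def, hXκ κ s]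
  have hremd : ∀ κ s, deriv (fun s : ℝ => remainder φ κ (s • e₀)) s =
      deriv Φ s * X (κ⁻¹ * s) + Φ s * (κ⁻¹ * deriv X (κ⁻¹ * s)) := by
    intro κ s
    have hc : HasDerivAt (fun s : ℝ => X (κ⁻¹ * s)) (deriv X (κ⁻¹ * s) * (κ⁻¹ * 1)) s :=
      (hXd (κ⁻¹ * s)).comp s ((hasDerivAt_id s).const_mul κ⁻¹)
    have h : HasDerivAt (fun s : ℝ => Φ s * X (κ⁻¹ * s))
        (deriv Φ s * X (κ⁻¹ * s) + Φ s * (deriv X (κ⁻¹ * s) * (κ⁻¹ * 1))) s := (hΦd s).mul hc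
    have e : (fun s : ℝ => remainder φ κ (s • e₀)) = fun s => Φ s * X (κ⁻¹ * s) := funext (hrem κ)
    rw [e, h.deriv]
    ring
  -- where `χ_κ'` lives: `κ⁻¹ ≤ |s|⁻¹`
  have hXd0 : ∀ {κ s : ℝ}, 0 < κ → κ < |s| → deriv X (κ⁻¹ * s) = 0 := by
    intro κ s hκ hs
    refine deriv_eq_zero_of_eventuallyEq_zero ?_
    have hopen : IsOpen {t : ℝ | 1 < |t|} := isOpen_lt continuous_const continuous_abs
    have h1 : 1 < |κ⁻¹ * s| := by
      rw [abs_mul, abs_inv, abs_of_pos hκ, ← div_eq_inv_mul, lt_div_iff₀ hκ, one_mul]; exact hs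
    filter_upwards [hopen.mem_nhds h1] with t ht
    exact hX0 t ht.le
  have hkey : ∀ {κ : ℝ}, 0 < κ → ∀ s, s ≠ 0 → |Φ s * (κ⁻¹ * deriv X (κ⁻¹ * s))| ≤ CX * (|s|⁻¹ * |Φ s|) := by
    intro κ hκ s hs0
    by_cases hs : κ < |s|
    · rw [hXd0 hκ hs]; simp; positivity
    · push Not at hs
      have hsi : κ⁻¹ ≤ |s|⁻¹ := by
        rw [inv_le_inv₀ hκ (abs_pos.2 hs0)]; exact hs
      rw [abs_mul, abs_mul, abs_inv, abs_of_pos hκ]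
      calc |Φ s| * (κ⁻¹ * |deriv X (κ⁻¹ * s)|) ≤ |Φ s| * (|s|⁻¹ * CX) := by gcongr; exact hCX _
        _ = CX * (|s|⁻¹ * |Φ s|) := by ring
  -- the dominating function
  set B : EuclideanSpace ℝ d → ℝ := fun ξ =>
    (ε ^ n)⁻¹ * (ε⁻¹ * (|deriv Φ (ε⁻¹ * ‖ξ‖)| + CX * (|ε⁻¹ * ‖ξ‖|⁻¹ * |Φ (ε⁻¹ * ‖ξ‖)|))) +
      ‖ξ‖⁻¹ * (2 * ((ε ^ n)⁻¹ * |Φ (ε⁻¹ * ‖ξ‖)|)) with hBdef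
  have hBint : Integrable B volume := by
    have hRs : ∀ r, ε * |R| < |r| → Φ (ε⁻¹ * r) = 0 := fun r hr => hΦsupp _ (by
      rw [abs_mul, abs_inv, abs_of_pos hε, ← div_eq_inv_mul, lt_div_iff₀ hε]
      calc R * ε ≤ |R| * ε := by gcongr; exact le_abs_self R
        _ = ε * |R| := mul_comm _ _
        _ < |r| := hr)
    have hRs' : ∀ r, ε * |R| < |r| → deriv Φ (ε⁻¹ * r) = 0 := by
      intro r hr
      refine deriv_eq_zero_of_eventuallyEq_zero ?_
      have hopen : IsOpen {t : ℝ | R < |t|} := isOpen_lt continuous_const continuous_abs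
      have h1 : R < |ε⁻¹ * r| := by
        rw [abs_mul, abs_inv, abs_of_pos hε, ← div_eq_inv_mul, lt_div_iff₀ hε]
        calc R * ε ≤ |R| * ε := by gcongr; exact le_abs_self R
          _ = ε * |R| := mul_comm _ _
          _ < |r| := hr
      filter_upwards [hopen.mem_nhds h1] with t ht
      exact hΦsupp t ht
    -- piece 1: continuous with compact support
    have h1 : Integrable (fun ξ : EuclideanSpace ℝ d => (ε ^ n)⁻¹ * (ε⁻¹ * |deriv Φ (ε⁻¹ * ‖ξ‖)|)) volume := by
      have hc : Continuous fun ξ : EuclideanSpace ℝ d => (ε ^ n)⁻¹ * (ε⁻¹ * |deriv Φ (ε⁻¹ * ‖ξ‖)|) := by fun_prop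
      refine hc.integrable_of_hasCompactSupport ?_
      refine HasCompactSupport.intro (isCompact_closedBall (0 : EuclideanSpace ℝ d) (ε * |R|)) fun ξ hξ => ?_
      have hξ' : ε * |R| < ‖ξ‖ := by simpa [dist_zero_right] using hξ
      show (ε ^ n)⁻¹ * (ε⁻¹ * |deriv Φ (ε⁻¹ * ‖ξ‖)|) = 0
      rw [hRs' _ (hξ'.trans_le (le_abs_self _)), abs_zero, mul_zero, mul_zero]
    -- pieces 2 and 3: `1/|ξ|` kernels
    have h2 : Integrable (fun ξ : EuclideanSpace ℝ d => ‖ξ‖⁻¹ * ((ε ^ n)⁻¹ * (CX * |Φ (ε⁻¹ * ‖ξ‖)|))) volume := by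
      refine integrable_inv_norm_mul_radial hn2 (R := ε * |R|) (X := fun r => (ε ^ n)⁻¹ * (CX * |Φ (ε⁻¹ * r)|))
        (by fun_prop) fun r hr => ?_
      show (ε ^ n)⁻¹ * (CX * |Φ (ε⁻¹ * r)|) = 0
      rw [hRs r hr, abs_zero, mul_zero, mul_zero]
    have h3 : Integrable (fun ξ : EuclideanSpace ℝ d => ‖ξ‖⁻¹ * (2 * ((ε ^ n)⁻¹ * |Φ (ε⁻¹ * ‖ξ‖)|))) volume := by
      refine integrable_inv_norm_mul_radial hn2 (R := ε * |R|) (X := fun r => 2 * ((ε ^ n)⁻¹ * |Φ (ε⁻¹ * r)|))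
        (by fun_prop) fun r hr => ?_
      show 2 * ((ε ^ n)⁻¹ * |Φ (ε⁻¹ * r)|) = 0
      rw [hRs r hr, abs_zero, mul_zero, mul_zero]
    have e : B = fun ξ => (ε ^ n)⁻¹ * (ε⁻¹ * |deriv Φ (ε⁻¹ * ‖ξ‖)|) +
        ‖ξ‖⁻¹ * ((ε ^ n)⁻¹ * (CX * |Φ (ε⁻¹ * ‖ξ‖)|)) + ‖ξ‖⁻¹ * (2 * ((ε ^ n)⁻¹ * |Φ (ε⁻¹ * ‖ξ‖)|)) := by
      funext ξ
      simp only [hBdef]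
      rw [abs_mul, abs_inv, abs_of_pos hε, abs_norm, mul_inv, inv_inv]
      field_simp
    rw [e]
    exact (h1.add h2).add h3
  -- measurability, bound, pointwise limit
  have hmeas : ∀ κ, AEStronglyMeasurable (fun ξ : EuclideanSpace ℝ d => |transverseWeight d (remainder φ κ) ε ‖ξ‖|) volume :=
    fun κ => (integrable_transverseWeight hn2 (hφ.remainder κ) hε).aestronglyMeasurable.norm
  have h0ae : ∀ᵐ ξ : EuclideanSpace ℝ d ∂volume, ξ ≠ 0 := by
    have h : ({(0 : EuclideanSpace ℝ d)}ᶜ : Set (EuclideanSpace ℝ d)) ∈ ae (volume : Measure (EuclideanSpace ℝ d)) :=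
      compl_mem_ae_iff.2 (measure_singleton 0)
    filter_upwards [h] with ξ hξ
    simpa using hξ
  have hW : ∀ κ (ξ : EuclideanSpace ℝ d), transverseWeight d (remainder φ κ) ε ‖ξ‖ =
      (ε ^ n)⁻¹ * (ε⁻¹ * (deriv Φ (ε⁻¹ * ‖ξ‖) * X (κ⁻¹ * (ε⁻¹ * ‖ξ‖)) +
        Φ (ε⁻¹ * ‖ξ‖) * (κ⁻¹ * deriv X (κ⁻¹ * (ε⁻¹ * ‖ξ‖))))) -
      ‖ξ‖⁻¹ * (2 * ((ε ^ n)⁻¹ * (Φ (ε⁻¹ * ‖ξ‖) * X (κ⁻¹ * (ε⁻¹ * ‖ξ‖))))) := fun κ ξ => by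
    rw [transverseWeight, hremd κ, ← he₀def, hrem κ]
  have hbound : ∀ᶠ κ in 𝓝[>] (0 : ℝ), ∀ᵐ ξ : EuclideanSpace ℝ d ∂volume,
      ‖|transverseWeight d (remainder φ κ) ε ‖ξ‖|‖ ≤ B ξ := by
    filter_upwards [self_mem_nhdsWithin] with κ hκ
    filter_upwards [h0ae] with ξ hξ
    have hs0 : ε⁻¹ * ‖ξ‖ ≠ 0 := mul_ne_zero (inv_ne_zero hε.ne') (norm_ne_zero_iff.2 hξ)
    rw [Real.norm_eq_abs, abs_abs, hW κ ξ, hBdef]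
    simp only
    have hk := hkey (mem_Ioi.1 hκ) (ε⁻¹ * ‖ξ‖) hs0
    have hx1 := hXb (κ⁻¹ * (ε⁻¹ * ‖ξ‖))
    have hεn : 0 < (ε ^ n)⁻¹ := by positivity
    have hεi : 0 < ε⁻¹ := by positivity
    calc |(ε ^ n)⁻¹ * (ε⁻¹ * (deriv Φ (ε⁻¹ * ‖ξ‖) * X (κ⁻¹ * (ε⁻¹ * ‖ξ‖)) +
            Φ (ε⁻¹ * ‖ξ‖) * (κ⁻¹ * deriv X (κ⁻¹ * (ε⁻¹ * ‖ξ‖))))) -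
          ‖ξ‖⁻¹ * (2 * ((ε ^ n)⁻¹ * (Φ (ε⁻¹ * ‖ξ‖) * X (κ⁻¹ * (ε⁻¹ * ‖ξ‖)))))|
        ≤ |(ε ^ n)⁻¹ * (ε⁻¹ * (deriv Φ (ε⁻¹ * ‖ξ‖) * X (κ⁻¹ * (ε⁻¹ * ‖ξ‖)) +
            Φ (ε⁻¹ * ‖ξ‖) * (κ⁻¹ * deriv X (κ⁻¹ * (ε⁻¹ * ‖ξ‖)))))| +
          |‖ξ‖⁻¹ * (2 * ((ε ^ n)⁻¹ * (Φ (ε⁻¹ * ‖ξ‖) * X (κ⁻¹ * (ε⁻¹ * ‖ξ‖)))))| := abs_sub _ _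
      _ ≤ (ε ^ n)⁻¹ * (ε⁻¹ * (|deriv Φ (ε⁻¹ * ‖ξ‖)| + CX * (|ε⁻¹ * ‖ξ‖|⁻¹ * |Φ (ε⁻¹ * ‖ξ‖)|))) +
          ‖ξ‖⁻¹ * (2 * ((ε ^ n)⁻¹ * |Φ (ε⁻¹ * ‖ξ‖)|)) := by
          gcongr
          · rw [abs_mul, abs_of_pos hεn, abs_mul, abs_of_pos hεi]
            gcongr
            refine (abs_add_le _ _).trans ?_
            refine add_le_add ?_ hk
            rw [abs_mul]
            exact mul_le_of_le_one_right (abs_nonneg _) hx1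
          · rw [abs_mul, abs_inv, abs_norm, abs_mul, abs_two, abs_mul, abs_of_pos hεn, abs_mul]
            gcongr
            exact mul_le_of_le_one_right (abs_nonneg _) hx1
  have hlim : ∀ᵐ ξ : EuclideanSpace ℝ d ∂volume,
      Tendsto (fun κ => |transverseWeight d (remainder φ κ) ε ‖ξ‖|) (𝓝[>] (0 : ℝ)) (𝓝 0) := by
    filter_upwards [h0ae] with ξ hξ
    have hs : 0 < ε⁻¹ * ‖ξ‖ := mul_pos (inv_pos.2 hε) (norm_pos_iff.2 hξ)
    refine tendsto_const_nhds.congr' ?_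
    filter_upwards [Ioo_mem_nhdsGT hs] with κ hκ
    have hκs : κ < |ε⁻¹ * ‖ξ‖| := hκ.2.trans_le (le_abs_self _)
    have hX0' : X (κ⁻¹ * (ε⁻¹ * ‖ξ‖)) = 0 := hX0 _ (by
      rw [abs_mul, abs_inv, abs_of_pos hκ.1, ← div_eq_inv_mul, le_div_iff₀ hκ.1, one_mul]; exact hκs.le)
    rw [hW κ ξ, hX0', hXd0 hκ.1 hκs]
    simp
  have h := tendsto_integral_filter_of_dominated_convergence B (Eventually.of_forall hmeas) hbound hBint hlim
  simpa using h

/-- **The transverse pairing is controlled by the `L¹` norm of its weight**: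
`‖∫₀ᵀ∫ D_T^{ε,φ} ψ‖ₑ ≤ |c_T| · 16C_ψ · 2 (∫⁻ |W_{φ,ε}(|ξ|)|)(∫⁻ ‖u‖ₑ³)` — the pointwise bound
`|W Q_T ψ| ≤ 16 C_ψ |W| (‖u(t,x+πξ)‖³ + ‖u(t,x)‖³)` (`|Q_T(ξ̂,δ)| ≤ 4|δ|³`, `|δ|³ ≤ 4(|u₊|³ + |u|³)`),
translation invariance and Tonelli. [folklore] -/
theorem enorm_integral_transverseApprox_le (hn2 : 2 ≤ Fintype.card d) (hφ : IsRadialBump φ)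
    (hu : AEStronglyMeasurable (uncurry u) ((volume.restrict (Ioo 0 T)).prod volume))
    (hu3 : ∫⁻ q, ‖uncurry u q‖ₑ ^ 3 ∂((volume.restrict (Ioo 0 T)).prod volume) < ⊤)
    (hψm : AEStronglyMeasurable (uncurry ψ) ((volume.restrict (Ioo 0 T)).prod volume))
    (hψb : ∀ t x, |ψ t x| ≤ Cψ) (hε : 0 < ε) :
    ‖∫ t in Ioo 0 T, ∫ x, eyinkTransverseApprox φ ε (u t) x * ψ t x‖ₑ ≤
      ‖eyinkTransverseConst d‖ₑ * (ENNReal.ofReal (16 * Cψ) *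
        ((∫⁻ ξ : EuclideanSpace ℝ d, ‖transverseWeight d φ ε ‖ξ‖‖ₑ) *
            (∫⁻ q, ‖uncurry u q‖ₑ ^ 3 ∂((volume.restrict (Ioo 0 T)).prod volume)) +
          (∫⁻ q, ‖uncurry u q‖ₑ ^ 3 ∂((volume.restrict (Ioo 0 T)).prod volume)) *
            ∫⁻ ξ : EuclideanSpace ℝ d, ‖transverseWeight d φ ε ‖ξ‖‖ₑ)) := by
  set μp : Measure (ℝ × UnitAddTorus d) := (volume.restrict (Ioo 0 T)).prod volume with hμp
  obtain ⟨hF, e⟩ := integral_transverseApprox_eq_triple hn2 hφ hu hu3 hψm hψb hε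
  have hCψ : 0 ≤ Cψ := (abs_nonneg _).trans (hψb 0 0)
  set W : EuclideanSpace ℝ d → ℝ := fun ξ => transverseWeight d φ ε ‖ξ‖ with hWdef
  have hWm : AEStronglyMeasurable W volume := (integrable_transverseWeight hn2 hφ hε).aestronglyMeasurable
  rw [e, enorm_mul]
  gcongr
  refine (enorm_integral_le_lintegral_enorm _).trans ?_
  -- pointwise bound in `ℝ≥0∞`
  have hpt : ∀ q : (ℝ × UnitAddTorus d) × EuclideanSpace ℝ d,
      ‖transverseWeight d φ ε ‖q.2‖ *
          (⟪increment (u q.1.1) q.2 q.1.2, ‖q.2‖⁻¹ • q.2⟫ *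
            ‖increment (u q.1.1) q.2 q.1.2 - ⟪increment (u q.1.1) q.2 q.1.2, ‖q.2‖⁻¹ • q.2⟫ • (‖q.2‖⁻¹ • q.2)‖ ^ 2) *
          ψ q.1.1 q.1.2‖ₑ ≤
        ENNReal.ofReal (16 * Cψ) * (‖W q.2‖ₑ * ‖u q.1.1 (q.1.2 + FunctionSpaces.Torus.proj q.2)‖ₑ ^ 3 +
          ‖uncurry u q.1‖ₑ ^ 3 * ‖W q.2‖ₑ) := by
    intro q
    have hQ := abs_cubicFormT_le (increment (u q.1.1) q.2 q.1.2) (norm_unitDir_le q.2)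
    have hδ := norm_sub_pow_three_le (u q.1.1 (q.1.2 + FunctionSpaces.Torus.proj q.2)) (u q.1.1 q.1.2)
    have hreal : |transverseWeight d φ ε ‖q.2‖ *
          (⟪increment (u q.1.1) q.2 q.1.2, ‖q.2‖⁻¹ • q.2⟫ *
            ‖increment (u q.1.1) q.2 q.1.2 - ⟪increment (u q.1.1) q.2 q.1.2, ‖q.2‖⁻¹ • q.2⟫ • (‖q.2‖⁻¹ • q.2)‖ ^ 2) *
          ψ q.1.1 q.1.2| ≤
        16 * Cψ * (|W q.2| * ‖u q.1.1 (q.1.2 + FunctionSpaces.Torus.proj q.2)‖ ^ 3 + ‖uncurry u q.1‖ ^ 3 * |W q.2|) := by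
      rw [abs_mul, abs_mul]
      have h3 : ‖increment (u q.1.1) q.2 q.1.2‖ ^ 3 ≤
          4 * (‖u q.1.1 (q.1.2 + FunctionSpaces.Torus.proj q.2)‖ ^ 3 + ‖uncurry u q.1‖ ^ 3) := hδ
      calc |transverseWeight d φ ε ‖q.2‖| *
            |⟪increment (u q.1.1) q.2 q.1.2, ‖q.2‖⁻¹ • q.2⟫ *
              ‖increment (u q.1.1) q.2 q.1.2 - ⟪increment (u q.1.1) q.2 q.1.2, ‖q.2‖⁻¹ • q.2⟫ • (‖q.2‖⁻¹ • q.2)‖ ^ 2| *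
            |ψ q.1.1 q.1.2|
          ≤ |W q.2| * (4 * (4 * (‖u q.1.1 (q.1.2 + FunctionSpaces.Torus.proj q.2)‖ ^ 3 + ‖uncurry u q.1‖ ^ 3))) * Cψ := by
            gcongr
            · exact hQ.trans (by gcongr)
            · exact hψb _ _
        _ = 16 * Cψ * (|W q.2| * ‖u q.1.1 (q.1.2 + FunctionSpaces.Torus.proj q.2)‖ ^ 3 + ‖uncurry u q.1‖ ^ 3 * |W q.2|) := by
            ring
    rw [Real.enorm_eq_ofReal_abs]
    refine (ENNReal.ofReal_le_ofReal hreal).trans (le_of_eq ?_)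
    rw [ENNReal.ofReal_mul (by positivity : (0 : ℝ) ≤ 16 * Cψ), ENNReal.ofReal_add (by positivity) (by positivity),
      ENNReal.ofReal_mul (abs_nonneg _), ENNReal.ofReal_mul (pow_nonneg (norm_nonneg (uncurry u q.1)) 3),
      ← Real.enorm_eq_ofReal_abs, ENNReal.ofReal_pow (norm_nonneg _), ENNReal.ofReal_pow (norm_nonneg _),
      ofReal_norm, ofReal_norm]
  refine (lintegral_mono fun q => hpt q).trans (le_of_eq ?_)
  -- Tonelli
  have hm1 : AEMeasurable (fun q : (ℝ × UnitAddTorus d) × EuclideanSpace ℝ d =>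
      ‖W q.2‖ₑ * ‖u q.1.1 (q.1.2 + FunctionSpaces.Torus.proj q.2)‖ₑ ^ 3) (μp.prod volume) :=
    (hWm.enorm.comp_quasiMeasurePreserving Measure.quasiMeasurePreserving_snd).mul
      ((aestronglyMeasurable_translate (ν := volume) hu FunctionSpaces.Torus.measurable_proj).enorm.pow_const 3)
  have hm2 : AEMeasurable (fun q : (ℝ × UnitAddTorus d) × EuclideanSpace ℝ d => ‖uncurry u q.1‖ₑ ^ 3 * ‖W q.2‖ₑ) (μp.prod volume) :=
    ((hu.enorm.pow_const 3).comp_quasiMeasurePreserving Measure.quasiMeasurePreserving_fst).mul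
      (hWm.enorm.comp_quasiMeasurePreserving Measure.quasiMeasurePreserving_snd)
  have hm12 : AEMeasurable (fun q : (ℝ × UnitAddTorus d) × EuclideanSpace ℝ d =>
      ‖W q.2‖ₑ * ‖u q.1.1 (q.1.2 + FunctionSpaces.Torus.proj q.2)‖ₑ ^ 3 + ‖uncurry u q.1‖ₑ ^ 3 * ‖W q.2‖ₑ) (μp.prod volume) :=
    hm1.add hm2
  rw [lintegral_const_mul'' _ hm12, lintegral_add_left' hm1,
    lintegral_mul_translate_enorm_pow (ν := volume) hu FunctionSpaces.Torus.measurable_proj hWm.enorm 3,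
    lintegral_prod_mul (hu.enorm.pow_const 3) hWm.enorm]

/-- **The remainder pairing vanishes**: at fixed `ε > 0`,
`∫₀ᵀ∫ D_T^{ε,φχ_κ}(u) ψ → 0` as `κ → 0⁺` (`d ≥ 2`, `u ∈ L³`, bounded `ψ`). [folklore] -/
theorem tendsto_integral_transverseApprox_remainder (hn2 : 2 ≤ Fintype.card d) (hφ : IsRadialBump φ)
    (hu : AEStronglyMeasurable (uncurry u) ((volume.restrict (Ioo 0 T)).prod volume))
    (hu3 : ∫⁻ q, ‖uncurry u q‖ₑ ^ 3 ∂((volume.restrict (Ioo 0 T)).prod volume) < ⊤)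
    (hψm : AEStronglyMeasurable (uncurry ψ) ((volume.restrict (Ioo 0 T)).prod volume))
    (hψb : ∀ t x, |ψ t x| ≤ Cψ) (hε : 0 < ε) :
    Tendsto (fun κ => ∫ t in Ioo 0 T, ∫ x, eyinkTransverseApprox (remainder φ κ) ε (u t) x * ψ t x)
      (𝓝[>] (0 : ℝ)) (𝓝 0) := by
  set μp : Measure (ℝ × UnitAddTorus d) := (volume.restrict (Ioo 0 T)).prod volume with hμp
  set I3 : ℝ≥0∞ := ∫⁻ q, ‖uncurry u q‖ₑ ^ 3 ∂μp with hI3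
  set L : ℝ → ℝ≥0∞ := fun κ => ∫⁻ ξ : EuclideanSpace ℝ d, ‖transverseWeight d (remainder φ κ) ε ‖ξ‖‖ₑ with hLdef
  -- `L κ → 0`
  have hL : Tendsto L (𝓝[>] (0 : ℝ)) (𝓝 0) := by
    have e : ∀ κ, L κ = ENNReal.ofReal (∫ ξ : EuclideanSpace ℝ d, |transverseWeight d (remainder φ κ) ε ‖ξ‖|) := fun κ => by
      show (∫⁻ ξ : EuclideanSpace ℝ d, ‖transverseWeight d (remainder φ κ) ε ‖ξ‖‖ₑ) = _
      rw [← ofReal_integral_norm_eq_lintegral_enorm (integrable_transverseWeight hn2 (hφ.remainder κ) hε)]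
      rfl
    rw [show L = fun κ => ENNReal.ofReal (∫ ξ : EuclideanSpace ℝ d, |transverseWeight d (remainder φ κ) ε ‖ξ‖|) from funext e,
      ← ENNReal.ofReal_zero]
    exact ENNReal.tendsto_ofReal (tendsto_integral_abs_transverseWeight_remainder hn2 hφ hε)
  -- the bound
  set C : ℝ≥0∞ := ‖eyinkTransverseConst d‖ₑ * ENNReal.ofReal (16 * Cψ) with hCdef
  have hbound : ∀ κ, ‖∫ t in Ioo 0 T, ∫ x, eyinkTransverseApprox (remainder φ κ) ε (u t) x * ψ t x‖ₑ ≤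
      C * (L κ * I3 + I3 * L κ) := fun κ => by
    have h := enorm_integral_transverseApprox_le hn2 (hφ.remainder κ) hu hu3 hψm hψb hε
    rw [hCdef, mul_assoc]
    exact h
  have hI3 : I3 ≠ ⊤ := hu3.ne
  have hC : C ≠ ⊤ := ENNReal.mul_ne_top enorm_ne_top ENNReal.ofReal_ne_top
  have hRHS : Tendsto (fun κ => C * (L κ * I3 + I3 * L κ)) (𝓝[>] (0 : ℝ)) (𝓝 0) := by
    have h1 : Tendsto (fun κ => L κ * I3) (𝓝[>] (0 : ℝ)) (𝓝 (0 * I3)) := ENNReal.Tendsto.mul_const hL (Or.inr hI3)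
    have h2 : Tendsto (fun κ => I3 * L κ) (𝓝[>] (0 : ℝ)) (𝓝 (I3 * 0)) := ENNReal.Tendsto.const_mul hL (Or.inr hI3)
    rw [zero_mul] at h1
    rw [mul_zero] at h2
    have h12 : Tendsto (fun κ => L κ * I3 + I3 * L κ) (𝓝[>] (0 : ℝ)) (𝓝 (0 + 0)) := h1.add h2
    rw [add_zero] at h12
    have h := ENNReal.Tendsto.const_mul h12 (Or.inr hC)
    rwa [mul_zero] at h
  -- squeeze in `ℝ`
  rw [tendsto_zero_iff_norm_tendsto_zero]
  have hup : Tendsto (fun κ => (C * (L κ * I3 + I3 * L κ)).toReal) (𝓝[>] (0 : ℝ)) (𝓝 0) := by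
    have h := (ENNReal.tendsto_toReal ENNReal.zero_ne_top).comp hRHS
    rw [ENNReal.toReal_zero] at h
    exact h
  refine squeeze_zero (fun κ => norm_nonneg _) (fun κ => ?_) hup
  rw [← toReal_enorm]
  have hfin : C * (L κ * I3 + I3 * L κ) ≠ ⊤ := by
    have hLκ : L κ ≠ ⊤ := by
      show (∫⁻ ξ : EuclideanSpace ℝ d, ‖transverseWeight d (remainder φ κ) ε ‖ξ‖‖ₑ) ≠ ⊤
      rw [← ofReal_integral_norm_eq_lintegral_enorm (integrable_transverseWeight hn2 (hφ.remainder κ) hε)]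
      exact ENNReal.ofReal_ne_top
    exact ENNReal.mul_ne_top hC (ENNReal.add_ne_top.2 ⟨ENNReal.mul_ne_top hLκ hI3, ENNReal.mul_ne_top hI3 hLκ⟩)
  exact ENNReal.toReal_mono hfin (hbound κ)

end Remainder

/-! ## Normalised excised mollifiers -/

section Normalise

variable [DecidableEq d] {φ : EuclideanSpace ℝ d → ℝ} {κ m : ℝ}

omit [DecidableEq d] in
/-- **The normalised excised mollifier** `m⁻¹ φ(1 − χ_κ)` (`m > 0` its would-be mass) of a radial
unit-ball mollifier is again a radial unit-ball mollifier when `∫ φ(1 − χ_κ) = m`, and it vanishes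
on the ball of radius `κ/2` (`κ > 0`). [folklore] -/
theorem isRadialUnitBallMollifier_normalise (hφ : IsRadialUnitBallMollifier φ) (hκ : 0 < κ) (hm : 0 < m)
    (hmass : ∫ ξ, excise φ κ ξ = m) :
    IsRadialUnitBallMollifier (fun ξ => m⁻¹ * excise φ κ ξ) ∧
      IsRadialBump (fun ξ => m⁻¹ * excise φ κ ξ) ∧ (∀ ξ, 0 ≤ m⁻¹ * excise φ κ ξ) ∧
      (∀ ξ, 1 < ‖ξ‖ → m⁻¹ * excise φ κ ξ = 0) ∧ ∀ ξ : EuclideanSpace ℝ d, ‖ξ‖ < κ / 2 → m⁻¹ * excise φ κ ξ = 0 := by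
  have hb : IsRadialBump φ := hφ.1.1.isRadialBump hφ.2
  have hbe : IsRadialBump (excise φ κ) := hb.excise κ
  have hφ0 : ∀ ξ, 0 ≤ φ ξ := hφ.1.1.2.2.2.1
  have hsm : ContDiff ℝ ∞ fun ξ => m⁻¹ * excise φ κ ξ := contDiff_const.mul hbe.smooth
  have hcs : HasCompactSupport fun ξ => m⁻¹ * excise φ κ ξ := hbe.hasCompactSupport.mul_left
  have hrad : ∀ ξ η : EuclideanSpace ℝ d, ‖ξ‖ = ‖η‖ → m⁻¹ * excise φ κ ξ = m⁻¹ * excise φ κ η :=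
    fun ξ η h => by rw [hbe.radial ξ η h]
  have hnn : ∀ ξ, 0 ≤ m⁻¹ * excise φ κ ξ := fun ξ => mul_nonneg (inv_nonneg.2 hm.le) (excise_nonneg hφ0 κ ξ)
  have hunit : ∀ ξ, 1 < ‖ξ‖ → m⁻¹ * excise φ κ ξ = 0 := fun ξ hξ => by rw [excise_eq_zero_of κ (hφ.1.2 ξ hξ), mul_zero]
  have hzero : ∀ ξ : EuclideanSpace ℝ d, ‖ξ‖ < κ / 2 → m⁻¹ * excise φ κ ξ = 0 := fun ξ hξ => by
    rw [excise_eq_zero_of_lt hκ hξ, mul_zero]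
  refine ⟨⟨⟨⟨hsm, hcs, fun ξ => hrad _ _ (norm_neg ξ), hnn, ?_⟩, hunit⟩, hrad⟩, ⟨hsm, hcs, hrad⟩, hnn, hunit, hzero⟩
  rw [integral_const_mul, hmass, inv_mul_cancel₀ hm.ne']

end Normalise

/-! ## The uniform transverse limit for weak Euler solutions -/

section Main

variable [DecidableEq d] {T : ℝ} {u : ℝ → UnitAddTorus d → EuclideanSpace ℝ d} {p : ℝ → UnitAddTorus d → ℝ}

/-- **The uniform transverse Eyink defect of a distributional Euler solution, from the matrix
facts.** Let `d ≥ 2`, `(u,p)` a distributional Euler solution on `T^d × (0,T)` with `u ∈ L³`,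
`p ∈ L^{3/2}`, and grant the two matrix-kernel facts. Then for every test function `ψ` supported in
`(0,T)`, `∫₀ᵀ∫ D_T^{ε,φ}(u) ψ → D(u,p)(ψ)` as `ε → 0⁺` **uniformly over spherically symmetric
unit-ball mollifiers `φ`**, where `D(u,p) = energyFluxFunctional T u p` is the Duchon–Robert energy
flux (Eyink 2003, Thm. 1, `X = T`, made uniform in `φ`). Proof: for the normalised excised profiles
`φ̃_κ = φ(1 − χ_κ)/m_κ` (radial unit-ball mollifiers vanishing near `0`), the identity
`𝓔_T^{ε,φ̃_κ}(ψ) = (4(d−1)/d)∫∫D_T^{ε,φ̃_κ}ψ` (`Torus.eyinkBalanceT_eq_of_matrix_facts`) and the uniform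
bound `|𝓔_T^{ε,φ̃_κ}(ψ) − (4(d−1)/d)D(u,p)(ψ)| < η` for `ε < ε₀(η)` (`Torus.eyinkBalanceT_sub_lt`) hold
for all `κ`; as `κ → 0⁺`, `∫∫D_T^{ε,φ̃_κ}ψ = m_κ⁻¹(∫∫D_T^{ε,φ}ψ − ∫∫D_T^{ε,φχ_κ}ψ) → ∫∫D_T^{ε,φ}ψ`. [cite: Eyink2003, §2 Thm. 1] -/
theorem tendstoUniformlyOn_transverseApprox_of_matrix_facts (hd : 2 ≤ Fintype.card d)
    (h1 : integral_matKernelFlux_mul_eq (d := d))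
    (h2 : IsDistributionalNSSolutionOn.matSymmTestField_identity (d := d))
    (hsol : IsDistributionalNSSolutionOn T 0 0 u p)
    (hu3 : ∫⁻ t in Ioo 0 T, ∫⁻ x, ‖u t x‖ₑ ^ 3 < ⊤)
    (hp32 : ∫⁻ t in Ioo 0 T, ∫⁻ x, ‖p t x‖ₑ ^ (3 / 2 : ℝ) < ⊤)
    {ψ : ℝ → UnitAddTorus d → ℝ} (hψ : FunctionSpaces.Torus.IsSpaceTimeTestIoo T ψ) :
    TendstoUniformlyOn
      (fun (ε : ℝ) (φ : EuclideanSpace ℝ d → ℝ) => ∫ t in Ioo 0 T, ∫ x, eyinkTransverseApprox φ ε (u t) x * ψ t x)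
      (fun _ => energyFluxFunctional T u p ψ) (𝓝[>] 0) {φ | IsRadialUnitBallMollifier φ} := by
  haveI : Nonempty d := Fintype.card_pos_iff.1 (by omega)
  have hn : (0 : ℝ) < Fintype.card d := by exact_mod_cast (show 0 < Fintype.card d by omega)
  have hn1 : (0 : ℝ) < (Fintype.card d : ℝ) - 1 := by
    have : (2 : ℝ) ≤ Fintype.card d := by exact_mod_cast hd
    linarith
  set c : ℝ := 4 * ((Fintype.card d : ℝ) - 1) / Fintype.card d with hcdef
  have hc : 0 < c := by positivity
  -- product forms of the data for the pairing lemmas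
  set μp : Measure (ℝ × UnitAddTorus d) := (volume.restrict (Ioo 0 T)).prod volume with hμp
  have hu : AEStronglyMeasurable (uncurry u) μp := aestronglyMeasurable_uncurry_prod_of_stLift_Ioo hsol.1
  have hu3' : ∫⁻ q, ‖uncurry u q‖ₑ ^ 3 ∂μp < ⊤ := lintegral_prod_enorm_pow_three_lt_top hu hu3
  have hψm : AEStronglyMeasurable (uncurry ψ) μp := hψ.continuous_uncurry.aestronglyMeasurable
  obtain ⟨Cψ, hψb⟩ := hψ.exists_abs_le
  set J : ℝ := energyFluxFunctional T u p ψ with hJdef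
  set P : (EuclideanSpace ℝ d → ℝ) → ℝ → ℝ := fun φ ε => ∫ t in Ioo 0 T, ∫ x, eyinkTransverseApprox φ ε (u t) x * ψ t x
    with hPdef
  rw [Metric.tendstoUniformlyOn_iff]
  intro η hη
  -- the uniform bound of `EyinkBalanceLimits`, at tolerance `c η / 2`
  obtain ⟨ε₀, hε₀, hlim⟩ := eyinkBalanceT_sub_lt (T := T) (u := u) (p := p) hsol.1 hu3 hsol.2.2.1 hp32 hψ
    (η := c * (η / 2)) (by positivity)
  filter_upwards [Ioo_mem_nhdsGT hε₀] with ε hε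
  intro φ hφ
  have hφ' : IsRadialUnitBallMollifier φ := hφ
  have hb : IsRadialBump φ := hφ'.1.1.isRadialBump hφ'.2
  have hφ0 : ∀ ξ, 0 ≤ φ ξ := hφ'.1.1.2.2.2.1
  have hφi : Integrable φ volume := hφ'.1.1.1.continuous.integrable_of_hasCompactSupport hφ'.1.1.2.1
  have hφc : Continuous φ := hφ'.1.1.1.continuous
  -- masses of the excised profiles
  set m : ℝ → ℝ := fun κ => ∫ ξ, excise φ κ ξ with hmdef
  have hmlim : Tendsto m (𝓝[>] (0 : ℝ)) (𝓝 1) := by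
    have h := tendsto_integral_excise (φ := φ) hφi hφ0 hφc
    rwa [hφ'.1.1.2.2.2.2] at h
  have hmpos : ∀ᶠ κ in 𝓝[>] (0 : ℝ), 0 < m κ :=
    (hmlim.eventually (lt_mem_nhds one_pos))
  -- the pairing of the normalised excised profile: identity and bound, for every admissible `κ`
  have hkey : ∀ᶠ κ in 𝓝[>] (0 : ℝ), |P (fun ξ => (m κ)⁻¹ * excise φ κ ξ) ε - J| < η / 2 := by
    filter_upwards [hmpos, self_mem_nhdsWithin] with κ hmκ hκ
    obtain ⟨hnm, hnb, hn0, hn1u, hnz⟩ := isRadialUnitBallMollifier_normalise hφ' (mem_Ioi.1 hκ) hmκ rfl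
    have hid := eyinkBalanceT_eq_of_matrix_facts hd h1 h2 hsol hu3 hp32 hnb hn0 hn1u (half_pos (mem_Ioi.1 hκ)) hnz hε.1 hψ
    have hbd := hlim _ hnm.1 hnm.2 ε hε
    rw [hid, ← energyFluxFunctional_apply] at hbd
    -- `|c P − c J| < c η/2`
    have e : c * P (fun ξ => (m κ)⁻¹ * excise φ κ ξ) ε - c * J = c * (P (fun ξ => (m κ)⁻¹ * excise φ κ ξ) ε - J) := by ring
    have hbd' : |c * (P (fun ξ => (m κ)⁻¹ * excise φ κ ξ) ε - J)| < c * (η / 2) := by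
      rw [← e]; exact hbd
    rw [abs_mul, abs_of_pos hc] at hbd'
    exact lt_of_mul_lt_mul_left hbd' hc.le
  -- the pairing of the normalised excised profile tends to the pairing of `φ` as `κ → 0⁺`
  have hdec : ∀ κ, P (fun ξ => (m κ)⁻¹ * excise φ κ ξ) ε = (m κ)⁻¹ * (P φ ε - P (remainder φ κ) ε) := by
    intro κ
    have hadd := integral_transverseApprox_add (T := T) (u := u) (ψ := ψ) hd (hb.excise κ) (hb.remainder κ) hu hu3' hψm hψb hε.1
    have hsum : (fun ξ => excise φ κ ξ + remainder φ κ ξ) = φ := funext (excise_add_remainder φ κ)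
    rw [hsum] at hadd
    show (∫ t in Ioo 0 T, ∫ x, eyinkTransverseApprox (fun ξ => (m κ)⁻¹ * excise φ κ ξ) ε (u t) x * ψ t x) =
      (m κ)⁻¹ * ((∫ t in Ioo 0 T, ∫ x, eyinkTransverseApprox φ ε (u t) x * ψ t x) -
        ∫ t in Ioo 0 T, ∫ x, eyinkTransverseApprox (remainder φ κ) ε (u t) x * ψ t x)
    rw [integral_transverseApprox_const_mul (hb.excise κ).smooth, hadd]
    ring
  have hPlim : Tendsto (fun κ => P (fun ξ => (m κ)⁻¹ * excise φ κ ξ) ε) (𝓝[>] (0 : ℝ)) (𝓝 (P φ ε)) := by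
    rw [show (fun κ => P (fun ξ => (m κ)⁻¹ * excise φ κ ξ) ε) = fun κ => (m κ)⁻¹ * (P φ ε - P (remainder φ κ) ε)
      from funext hdec]
    have hrem := tendsto_integral_transverseApprox_remainder (T := T) (u := u) (ψ := ψ) hd hb hu hu3' hψm hψb hε.1
    have h := (hmlim.inv₀ one_ne_zero).mul ((tendsto_const_nhds (x := P φ ε)).sub hrem)
    simpa using h
  -- pass to the limit in the strict bound
  have hle : |P φ ε - J| ≤ η / 2 :=
    le_of_tendsto ((hPlim.sub_const J).abs) (hkey.mono fun κ hκ => hκ.le)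
  rw [Real.dist_eq, abs_sub_comm]
  linarith

end Main

/-! ## The local 4/5 law from the pressure fact alone -/

section FourFifths

variable {T : ℝ} {u : ℝ → UnitAddTorus d → EuclideanSpace ℝ d}

/-- **`HasDuchonRobertDefect.hasFourFifthsLaw` in dimension `d ≥ 2` from the pressure fact alone.**
With Duchon–Robert's cubic identity, the tested momentum equations (scalar and matrix) and Novack's
matrix cubic identity all discharged in the tree (`Torus.integral_kernelFlux_mul_eq_holds`,
`Torus.symmTestField_identity_holds`, `Torus.integral_matKernelFlux_mul_eq_holds`,
`Torus.IsDistributionalNSSolutionOn.matSymmTestField_identity_holds`), the accepted fact follows from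
the `L^{3/2}` pressure fact `Torus.exists_pressure_of_tendsto_L3`: the 4/3 law
(`Torus.hasFourThirdsLaw_of_symmTestField_identity_of_pressure`), the uniform transverse Eyink defect
(`tendstoUniformlyOn_transverseApprox_of_matrix_facts`, its limit `D(u,p)` identified with the given
defect by uniqueness, `Torus.hasUniformDuchonRobertDefect_of_steps`), and
`Torus.HasFourThirdsLaw.hasFourFifthsLaw_of_uniformTransverse` (Eyink 2003, Cor. 1: only the
transverse balance is needed once the 4/3 law is available). [cite: Eyink2003, §2 Thm. 1 and Cor. 1] -/
theorem hasFourFifthsLaw_of_pressure_fact_of_two_le [instD : DecidableEq d] (hd : 2 ≤ Fintype.card d)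
    (hA1 : exists_pressure_of_tendsto_L3 (T := T) (u := u)) :
    HasDuchonRobertDefect.hasFourFifthsLaw (T := T) (u := u) := by
  intro instD' D h hE hu3
  have e : instD' = instD := Subsingleton.elim _ _
  subst e
  obtain ⟨p, hsol, hp32⟩ := exists_pressure_of_fact' hA1 hE hu3
  -- the 4/3 law
  have h43 : HasFourThirdsLaw T u D :=
    hasFourThirdsLaw_of_symmTestField_identity_of_pressure (fun {_} => symmTestField_identity_holds) hA1 h hE hu3
  -- the energy flux functional is a Duchon–Robert defect, hence agrees with `D` on test functions
  have hJ : HasDuchonRobertDefect T u (energyFluxFunctional T u p) :=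
    (hasUniformDuchonRobertDefect_of_steps integral_kernelFlux_mul_eq_holds symmTestField_identity_holds hsol hu3 hp32).hasDuchonRobertDefect
  have hDJ : ∀ ψ : ℝ → UnitAddTorus d → ℝ, FunctionSpaces.Torus.IsSpaceTimeTestIoo T ψ → D ψ = energyFluxFunctional T u p ψ :=
    fun ψ hψ => h.unique hJ hψ
  -- the uniform transverse limit, with limit `D ψ`
  have hT : ∀ ψ : ℝ → UnitAddTorus d → ℝ, FunctionSpaces.Torus.IsSpaceTimeTestIoo T ψ →
      TendstoUniformlyOn
        (fun (ε : ℝ) (φ : EuclideanSpace ℝ d → ℝ) => ∫ t in Ioo 0 T, ∫ x, eyinkTransverseApprox φ ε (u t) x * ψ t x)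
        (fun _ => D ψ) (𝓝[>] 0) {φ | IsRadialUnitBallMollifier φ} := by
    intro ψ hψ
    rw [hDJ ψ hψ]
    exact tendstoUniformlyOn_transverseApprox_of_matrix_facts hd integral_matKernelFlux_mul_eq_holds
      IsDistributionalNSSolutionOn.matSymmTestField_identity_holds hsol hu3 hp32 hψ
  exact h43.hasFourFifthsLaw_of_uniformTransverse hd hT hE.1 hu3

/-- **`HasDuchonRobertDefect.hasFourFifthsLaw` from the pressure fact, in every dimension** (`d = 0, 1`
unconditionally, `EyinkUniformDefectOfEuler`). Feeding it a discharge of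
`Torus.exists_pressure_of_tendsto_L3` gives `HasDuchonRobertDefect.hasFourFifthsLaw_holds`. [cite: Eyink2003, §2 Thm. 1 and Cor. 1] -/
theorem hasFourFifthsLaw_of_pressure_fact [instD : DecidableEq d]
    (hA1 : exists_pressure_of_tendsto_L3 (T := T) (u := u)) :
    HasDuchonRobertDefect.hasFourFifthsLaw (T := T) (u := u) := by
  intro instD' D h hE hu3
  have e : instD' = instD := Subsingleton.elim _ _
  subst e
  rcases Nat.lt_or_ge (Fintype.card d) 2 with hlt | hge
  · rcases (by omega : Fintype.card d = 0 ∨ Fintype.card d = 1) with h0 | h1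
    · haveI : IsEmpty d := Fintype.card_eq_zero_iff.mp h0
      exact hasFourFifthsLaw_of_isEmpty h hE hu3
    · exact hasFourFifthsLaw_of_card_eq_one h1 h hE hu3
  · exact hasFourFifthsLaw_of_pressure_fact_of_two_le hge hA1 h hE hu3

end FourFifths

end Literature.Analysis.FluidPDE.Torus
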